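import Mathlib
import Summits.Ventures.LatticeQCDFlow.TrivializingMaps.RankOne
import HarnessLib

/-!
# The Lipschitz identity for slot matrix coefficients (Kronecker telescoping)

HONEST FRAMING. This venture is about exact (Metropolis-corrected) sampling algorithms for lattice
gauge theory; figures of merit are autocorrelation/cost numbers at stated couplings and volumes; no
continuum-physics claim. This file is pure finite-dimensional linear algebra.

WHAT IS PROVED (theory-1 row 80a; the engine of `TruncatedGeneratorLipschitz.lean` = `K_Z` of
THEOREM L). Every term of Lüscher's graded flow-action series is a matrix coefficient
`Re(z ⟪y, R_σ(U) x⟫)` of the slot representation `R_σ(U) = ⊗_s u_s` (`SlotRepresentation.slotRep`), a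
Kronecker product of the unitaries `u_s = U(lnk s)^{(±)}`. Exchanging the factors one slot at a time
(hybrid telescoping), `⊗_s u_s − ⊗_s u'_s = ∑_s ins_s(u_s − u'_s) · (⊗ of unitaries)`, and an insertion
`ins_s(X) = 1 ⊗ … ⊗ X ⊗ … ⊗ 1` acts with operator norm `≤ ∑_{ij} |X_{ij}| ≤ n ‖X‖_F` (each
`ins_s(E_{ij} c)` is `|c|` times a partial isometry: `Eᴴ E = |c|² P`, `P = ins_s(E_{jj})` a Hermitian
idempotent). Hence, between ANY two unitary configurations `W, W'` (no path, no mean-value theorem,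
no matrix logarithm):

* `norm_toE_kronPi_sub_apply_le`: `‖(⊗u) v − (⊗u') v‖ ≤ (∑_s ∑_{ij} |(u_s − u'_s)_{ij}|) ‖v‖`;
* `abs_termF_sub_termF_le` (THE LIPSCHITZ IDENTITY):
  `|Re(z⟪y,R_σ(W)x⟫) − Re(z⟪y,R_σ(W')x⟫)| ≤ |z| ‖x‖ ‖y‖ · ∑_s ∑_{ij} |(W − W')(lnk s)_{ij}|`;
* `abs_linkDeriv_termF_sub_le`: the same for a link derivative `∂^a_e` of a datum with bra vector in a
  joint Casimir block, with the extra factor `√m_e` of `SlotHilbert.norm_genCLM_jointProj_le` (because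
  `∂^a_e Re(z⟪y,Rx⟫) = −Re(z⟪T^{σ,e}_a y, Rx⟫)`, `RankOne.linkDeriv_termF_skew`);
* `sum_norm_apply_le_mul_norm`: `∑_{ij} |X_{ij}| ≤ n ‖X‖_F` (Cauchy–Schwarz).

Sources: hybrid/telescoping estimates for tensor products are folklore (e.g. the Lieb–Robinson
literature, arXiv:0902.0025 §2); the objects are those of [Luscher2010Trivializing] M. Lüscher, Commun.
Math. Phys. 293 (2010) 899, arXiv:0907.5491, §4. Everything is [ours] unless marked [folklore].
-/

open scoped Matrix ComplexConjugate InnerProductSpace Matrix.Norms.Frobenius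
open Finset

/-! ## 1. Slot algebra: exchanging one Kronecker factor -/

namespace Summit.Ventures.LatticeQCDFlow.TrivializingMaps.SlotRepresentation

variable {n : ℕ} {σ : Type*} [Fintype σ] [DecidableEq σ]

/-- Kronecker products are additive in each factor: differences. [folklore] -/
theorem kronPi_update_sub (A : σ → Matrix (Fin n) (Fin n) ℂ) (s : σ) (Z Z' : Matrix (Fin n) (Fin n) ℂ) :
    kronPi (Function.update A s (Z - Z')) =
      kronPi (Function.update A s Z) - kronPi (Function.update A s Z') := by
  ext I J
  simp only [Matrix.sub_apply, kronPi_update_apply, sub_mul]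

/-- Replacing the factor at slot `s` by `Z` = inserting `Z` in front of the product with `1` at `s`.
[folklore] -/
theorem kronPi_update_eq_ins_mul (A : σ → Matrix (Fin n) (Fin n) ℂ) (s : σ) (Z : Matrix (Fin n) (Fin n) ℂ) :
    kronPi (Function.update A s Z) = ins s Z * kronPi (Function.update A s 1) := by
  rw [ins_mul_kronPi, Function.update_self, mul_one, Function.update_idem]

/-- Insertion of `0` is `0`. [folklore] -/
theorem ins_zero (s : σ) : ins s (0 : Matrix (Fin n) (Fin n) ℂ) = 0 := by
  ext I J; simp only [ins_apply, Matrix.zero_apply, zero_mul]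

/-- Insertion is additive: finite sums. [folklore] -/
theorem ins_sum {κ : Type*} (s : σ) (S : Finset κ) (Z : κ → Matrix (Fin n) (Fin n) ℂ) :
    ins s (∑ k ∈ S, Z k) = ∑ k ∈ S, ins s (Z k) := by
  classical
  refine Finset.induction_on S ?_ ?_
  · simp only [Finset.sum_empty, ins_zero]
  · intro k S hk ih
    rw [Finset.sum_insert hk, Finset.sum_insert hk, ins_add, ih]

/-- `ins s (E_{ij} c)ᴴ · ins s (E_{ij} c) = |c|² · ins s (E_{jj})`. [folklore] -/
theorem ins_single_conjTranspose_mul (s : σ) (i j : Fin n) (c : ℂ) :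
    (ins s (Matrix.single i j c))ᴴ * ins s (Matrix.single i j c) =
      ((starRingEnd ℂ) c * c) • ins s (Matrix.single j j (1 : ℂ)) := by
  rw [ins_conjTranspose, Matrix.conjTranspose_single, ← ins_mul, Matrix.single_mul_single_same,
    ← ins_smul, Matrix.smul_single, smul_eq_mul, mul_one]
  rfl

/-- `ins s (E_{jj})` is an idempotent. [folklore] -/
theorem ins_single_diag_mul_self (s : σ) (j : Fin n) :
    ins s (Matrix.single j j (1 : ℂ)) * ins s (Matrix.single j j (1 : ℂ)) =
      ins s (Matrix.single j j (1 : ℂ)) := by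
  rw [← ins_mul, Matrix.single_mul_single_same, mul_one]

/-- `ins s (E_{jj})` is Hermitian. [folklore] -/
theorem ins_single_diag_conjTranspose (s : σ) (j : Fin n) :
    (ins s (Matrix.single j j (1 : ℂ)))ᴴ = ins s (Matrix.single j j (1 : ℂ)) := by
  rw [ins_conjTranspose, Matrix.conjTranspose_single, star_one]

end Summit.Ventures.LatticeQCDFlow.TrivializingMaps.SlotRepresentation

namespace Summit.Ventures.LatticeQCDFlow.TrivializingMaps.SlotHilbert

open SlotRepresentation

variable {n : ℕ} {σ : Type*} [Fintype σ] [DecidableEq σ]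

/-- `toE` is additive: differences. [folklore] -/
theorem toE_sub (A A' : Matrix (σ → Fin n) (σ → Fin n) ℂ) : toE (A - A') = toE A - toE A' := by
  unfold toE; exact map_sub _ A A'

/-- `toE` is `ℂ`-homogeneous. [folklore] -/
theorem toE_smul (c : ℂ) (A : Matrix (σ → Fin n) (σ → Fin n) ℂ) : toE (c • A) = c • toE A := by
  unfold toE; exact map_smul _ c A

/-- A Hermitian idempotent matrix acts as a contraction: `‖P v‖ ≤ ‖v‖`. [folklore] -/
theorem norm_toE_apply_le_of_proj {P : Matrix (σ → Fin n) (σ → Fin n) ℂ} (hPP : P * P = P)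
    (hPh : Pᴴ = P) (v : SlotSpace σ n) : ‖toE P v‖ ≤ ‖v‖ := by
  have h1 : (⟪toE P v, toE P v⟫_ℂ) = ⟪v, toE P v⟫_ℂ := by
    rw [← ContinuousLinearMap.adjoint_inner_right, ← toE_conjTranspose, hPh,
      ← ContinuousLinearMap.comp_apply, ← toE_mul, hPP]
  have h2 : ‖toE P v‖ ^ 2 ≤ ‖v‖ * ‖toE P v‖ := by
    rw [← inner_self_eq_norm_sq (𝕜 := ℂ), h1]
    exact (RCLike.re_le_norm _).trans (norm_inner_le_norm _ _)
  by_cases h : ‖toE P v‖ = 0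
  · rw [h]; exact norm_nonneg _
  · have hpos : 0 < ‖toE P v‖ := lt_of_le_of_ne (norm_nonneg _) (Ne.symm h)
    rw [pow_two] at h2
    exact le_of_mul_le_mul_right h2 hpos

/-- An inserted matrix unit acts with norm `≤ |c|`: `‖ins s (E_{ij} c) v‖ ≤ |c| ‖v‖`. [folklore] -/
theorem norm_toE_ins_single_apply_le (s : σ) (i j : Fin n) (c : ℂ) (v : SlotSpace σ n) :
    ‖toE (ins s (Matrix.single i j c)) v‖ ≤ ‖c‖ * ‖v‖ := by
  set E := ins s (Matrix.single i j c) with hE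
  set P := ins s (Matrix.single j j (1 : ℂ)) with hP
  have hsq : ‖toE E v‖ ^ 2 = ‖c‖ ^ 2 * RCLike.re ⟪v, toE P v⟫_ℂ := by
    rw [← inner_self_eq_norm_sq (𝕜 := ℂ), ← ContinuousLinearMap.adjoint_inner_right,
      ← toE_conjTranspose, ← ContinuousLinearMap.comp_apply, ← toE_mul, hE,
      ins_single_conjTranspose_mul, toE_smul, _root_.smul_apply, inner_smul_right, ← hP, Complex.conj_mul', RCLike.re_eq_complex_re, ← Complex.ofReal_pow,
      Complex.re_ofReal_mul]
  have hre : RCLike.re ⟪v, toE P v⟫_ℂ ≤ ‖v‖ ^ 2 := by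
    calc RCLike.re ⟪v, toE P v⟫_ℂ ≤ ‖⟪v, toE P v⟫_ℂ‖ := RCLike.re_le_norm _
      _ ≤ ‖v‖ * ‖toE P v‖ := norm_inner_le_norm _ _
      _ ≤ ‖v‖ * ‖v‖ := by
        gcongr
        exact norm_toE_apply_le_of_proj (ins_single_diag_mul_self s j)
          (ins_single_diag_conjTranspose s j) v
      _ = ‖v‖ ^ 2 := (pow_two _).symm
  have h3 : ‖toE E v‖ ^ 2 ≤ (‖c‖ * ‖v‖) ^ 2 := by
    rw [hsq, mul_pow]
    exact mul_le_mul_of_nonneg_left hre (sq_nonneg _)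
  exact (pow_le_pow_iff_left₀ (norm_nonneg _) (by positivity) two_ne_zero).1 h3

/-- **Operator norm of an insertion**: `‖ins s X v‖ ≤ (∑_{ij} |X_{ij}|) ‖v‖`. [folklore] -/
theorem norm_toE_ins_apply_le (s : σ) (X : Matrix (Fin n) (Fin n) ℂ) (v : SlotSpace σ n) :
    ‖toE (ins s X) v‖ ≤ (∑ i, ∑ j, ‖X i j‖) * ‖v‖ := by
  have hX : toE (ins s X) v = ∑ i, ∑ j, toE (ins s (Matrix.single i j (X i j))) v := by
    conv_lhs => rw [Matrix.matrix_eq_sum_single X]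
    rw [ins_sum, toE_sum, _root_.sum_apply]
    refine Finset.sum_congr rfl fun i _ => ?_
    rw [ins_sum, toE_sum, _root_.sum_apply]
  rw [hX, Finset.sum_mul]
  refine (norm_sum_le _ _).trans (Finset.sum_le_sum fun i _ => ?_)
  rw [Finset.sum_mul]
  exact (norm_sum_le _ _).trans (Finset.sum_le_sum fun j _ => norm_toE_ins_single_apply_le s i j _ v)

/-- **Hybrid telescoping**: two Kronecker products of unitaries differ, as operators, by at most the
sum over the slots of the insertion norms of the factor differences. [folklore] -/
theorem norm_toE_kronPi_sub_apply_le {u u' : σ → Matrix (Fin n) (Fin n) ℂ}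
    (hu : ∀ s, u s ∈ Matrix.unitaryGroup (Fin n) ℂ) (hu' : ∀ s, u' s ∈ Matrix.unitaryGroup (Fin n) ℂ)
    (v : SlotSpace σ n) :
    ‖toE (kronPi u) v - toE (kronPi u') v‖ ≤ (∑ s, ∑ i, ∑ j, ‖(u s - u' s) i j‖) * ‖v‖ := by
  -- hybrids: `u'` on `S`, `u` off `S`
  have key : ∀ S : Finset σ,
      ‖toE (kronPi fun s => if s ∈ S then u' s else u s) v - toE (kronPi u) v‖ ≤
        (∑ s ∈ S, ∑ i, ∑ j, ‖(u s - u' s) i j‖) * ‖v‖ := by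
    intro S
    refine Finset.induction_on S ?_ ?_
    · simp only [Finset.notMem_empty, if_false, sub_self, norm_zero, Finset.sum_empty, zero_mul, le_refl]
    · intro s S hs ih
      set H : σ → Matrix (Fin n) (Fin n) ℂ := fun s' => if s' ∈ S then u' s' else u s' with hH
      have hins : (fun s' => if s' ∈ insert s S then u' s' else u s') = Function.update H s (u' s) := by
        funext s'
        rcases eq_or_ne s' s with rfl | hne
        · simp only [Finset.mem_insert, true_or, if_true, Function.update_self]
        · simp only [Finset.mem_insert, hne, false_or, Function.update_of_ne hne, hH]
      have hself : H = Function.update H s (u s) := by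
        rw [eq_comm, Function.update_eq_self_iff, hH]
        simp only [hs, if_false]
      have hunit : ∀ s', Function.update H s (1 : Matrix (Fin n) (Fin n) ℂ) s' ∈
          Matrix.unitaryGroup (Fin n) ℂ := by
        intro s'
        rcases eq_or_ne s' s with rfl | hne
        · rw [Function.update_self]; exact Submonoid.one_mem _
        · rw [Function.update_of_ne hne, hH]
          dsimp only
          split_ifs
          · exact hu' s'
          · exact hu s'
      have hdiff : kronPi (Function.update H s (u' s)) - kronPi H =
          ins s (u' s - u s) * kronPi (Function.update H s 1) := by
        conv_lhs => rw [show kronPi H = kronPi (Function.update H s (u s)) by rw [← hself]]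
        rw [← kronPi_update_sub, kronPi_update_eq_ins_mul]
      have hstep : ‖toE (kronPi fun s' => if s' ∈ insert s S then u' s' else u s') v - toE (kronPi H) v‖
          ≤ (∑ i, ∑ j, ‖(u s - u' s) i j‖) * ‖v‖ := by
        rw [hins, ← _root_.sub_apply, ← toE_sub, hdiff, toE_mul, ContinuousLinearMap.comp_apply]
        refine (norm_toE_ins_apply_le s _ _).trans ?_
        rw [norm_toE_apply_of_mem_unitary (kronPi_mem_unitaryGroup hunit) v]
        refine le_of_eq (congrArg (· * ‖v‖) (Finset.sum_congr rfl fun i _ =>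
          Finset.sum_congr rfl fun j _ => ?_))
        rw [← norm_neg, Matrix.sub_apply, Matrix.sub_apply, neg_sub]
      calc ‖toE (kronPi fun s' => if s' ∈ insert s S then u' s' else u s') v - toE (kronPi u) v‖
          ≤ ‖toE (kronPi fun s' => if s' ∈ insert s S then u' s' else u s') v - toE (kronPi H) v‖ +
            ‖toE (kronPi H) v - toE (kronPi u) v‖ := norm_sub_le_norm_sub_add_norm_sub _ _ _
        _ ≤ (∑ i, ∑ j, ‖(u s - u' s) i j‖) * ‖v‖ + (∑ s ∈ S, ∑ i, ∑ j, ‖(u s - u' s) i j‖) * ‖v‖ :=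
            add_le_add hstep ih
        _ = (∑ s ∈ insert s S, ∑ i, ∑ j, ‖(u s - u' s) i j‖) * ‖v‖ := by
            rw [Finset.sum_insert hs, add_mul]
  have h := key Finset.univ
  simp only [Finset.mem_univ, if_true] at h
  rw [← norm_neg, neg_sub] at h
  exact h

end Summit.Ventures.LatticeQCDFlow.TrivializingMaps.SlotHilbert

/-! ## 2. The Lipschitz identity for slot matrix coefficients -/

namespace Summit.Ventures.LatticeQCDFlow.TrivializingMaps.SlotRepresentation

variable {n : ℕ}

/-- Polarities respect subtraction. [folklore] -/
theorem polM_sub (b : Bool) (M N : Matrix (Fin n) (Fin n) ℂ) : polM b (M - N) = polM b M - polM b N := by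
  cases b <;> simp [Matrix.map_sub]

/-- Polarities preserve the entrywise `ℓ¹` norm. [folklore] -/
theorem sum_norm_polM_apply (b : Bool) (M : Matrix (Fin n) (Fin n) ℂ) :
    ∑ i, ∑ j, ‖polM b M i j‖ = ∑ i, ∑ j, ‖M i j‖ := by
  cases b <;> simp [Matrix.map_apply]

/-- Entrywise `ℓ¹` norm versus Frobenius norm: `∑_{ij} |X_{ij}| ≤ n ‖X‖_F` (Cauchy–Schwarz). [folklore] -/
theorem sum_norm_apply_le_mul_norm (X : Matrix (Fin n) (Fin n) ℂ) :
    ∑ i, ∑ j, ‖X i j‖ ≤ n * ‖X‖ := by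
  have hS : ∑ i, ∑ j, ‖X i j‖ = ∑ p : Fin n × Fin n, 1 * ‖X p.1 p.2‖ := by
    rw [Fintype.sum_prod_type]; simp only [one_mul]
  have hCS := Finset.sum_mul_sq_le_sq_mul_sq Finset.univ (fun _ : Fin n × Fin n => (1 : ℝ))
    (fun p => ‖X p.1 p.2‖)
  have h1 : ∑ p : Fin n × Fin n, (1 : ℝ) ^ 2 = (n : ℝ) ^ 2 := by
    simp only [Finset.sum_const, Finset.card_univ, Fintype.card_prod, Fintype.card_fin, nsmul_eq_mul,
      mul_one, Nat.cast_mul, pow_two]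
  have h2 : ∑ p : Fin n × Fin n, ‖X p.1 p.2‖ ^ 2 = ‖X‖ ^ 2 := by
    rw [Literature.MathematicalPhysics.QuantumFieldTheory.WilsonFlow.frobenius_norm_sq,
      Fintype.sum_prod_type]
  rw [h1, h2, ← mul_pow, ← hS] at hCS
  exact (pow_le_pow_iff_left₀ (by positivity) (by positivity) two_ne_zero).1 hCS

end Summit.Ventures.LatticeQCDFlow.TrivializingMaps.SlotRepresentation

namespace Summit.Ventures.LatticeQCDFlow.TrivializingMaps.RankOne

open Literature.MathematicalPhysics.QuantumFieldTheory
open Literature.MathematicalPhysics.QuantumFieldTheory.Luscher2010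
open SlotRepresentation SlotCasimir SlotHilbert JointGrading CasimirGrading

variable {n : ℕ} {σ : Type*} [Fintype σ] [DecidableEq σ] {d L : ℕ}
variable (lnk : σ → Edge d L) (pol : σ → Bool) (z : ℂ) (x : SlotSpace σ n)

/-- **The slot representation is Lipschitz on unitaries** (operator form):
`‖R_σ(W) x − R_σ(W') x‖ ≤ (∑_s ∑_{ij} |(W − W')(lnk s)_{ij}|) ‖x‖`. [ours] -/
theorem norm_repCLM_sub_repCLM_apply_le {W W' : AmbConfig d L n}
    (hW : ∀ e, W e ∈ Matrix.unitaryGroup (Fin n) ℂ) (hW' : ∀ e, W' e ∈ Matrix.unitaryGroup (Fin n) ℂ) :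
    ‖repCLM lnk pol W x - repCLM lnk pol W' x‖
      ≤ (∑ s, ∑ i, ∑ j, ‖(W (lnk s) - W' (lnk s)) i j‖) * ‖x‖ := by
  have h := norm_toE_kronPi_sub_apply_le (u := fun s => polM (pol s) (W (lnk s)))
    (u' := fun s => polM (pol s) (W' (lnk s))) (fun s => polM_mem_unitaryGroup _ (hW _))
    (fun s => polM_mem_unitaryGroup _ (hW' _)) x
  simp only [← polM_sub, sum_norm_polM_apply] at h
  exact h

/-- **LIPSCHITZ IDENTITY for slot matrix coefficients**: between any two unitary configurations,
`|Re(z⟪y,R_σ(W)x⟫) − Re(z⟪y,R_σ(W')x⟫)| ≤ |z| ‖x‖ ‖y‖ ∑_s ∑_{ij} |(W − W')(lnk s)_{ij}|`. [ours] -/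
theorem abs_termF_sub_termF_le (y : SlotSpace σ n) {W W' : AmbConfig d L n}
    (hW : ∀ e, W e ∈ Matrix.unitaryGroup (Fin n) ℂ) (hW' : ∀ e, W' e ∈ Matrix.unitaryGroup (Fin n) ℂ) :
    |termF lnk pol z x y W - termF lnk pol z x y W'|
      ≤ ‖z‖ * ‖x‖ * ‖y‖ * ∑ s, ∑ i, ∑ j, ‖(W (lnk s) - W' (lnk s)) i j‖ := by
  rw [termF_apply, termF_apply, ← Complex.sub_re, ← mul_sub, ← inner_sub_right]
  refine (Complex.abs_re_le_norm _).trans ?_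
  rw [norm_mul]
  calc ‖z‖ * ‖⟪y, repCLM lnk pol W x - repCLM lnk pol W' x⟫_ℂ‖
      ≤ ‖z‖ * (‖y‖ * ‖repCLM lnk pol W x - repCLM lnk pol W' x‖) :=
        mul_le_mul_of_nonneg_left (norm_inner_le_norm _ _) (norm_nonneg z)
    _ ≤ ‖z‖ * (‖y‖ * ((∑ s, ∑ i, ∑ j, ‖(W (lnk s) - W' (lnk s)) i j‖) * ‖x‖)) := by
        gcongr
        exact norm_repCLM_sub_repCLM_apply_le lnk pol x hW hW'
    _ = ‖z‖ * ‖x‖ * ‖y‖ * ∑ s, ∑ i, ∑ j, ‖(W (lnk s) - W' (lnk s)) i j‖ := by ring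

variable (B : SuBasis n)

/-- **Lipschitz bound for a link derivative of a datum**: for `y = P_m v`,
`|∂^a_e termF(z,x,y)(W) − ∂^a_e termF(z,x,y)(W')| ≤ |z| ‖x‖ √(mₑ) ‖y‖ ∑_s ∑_{ij} |(W − W')(lnk s)_{ij}|`.
[ours] -/
theorem abs_linkDeriv_termF_sub_le (m : Modes (casimirFamily lnk pol B)) (v : SlotSpace σ n)
    (e : Edge d L) (a : B.ι) {W W' : AmbConfig d L n}
    (hW : ∀ e, W e ∈ Matrix.unitaryGroup (Fin n) ℂ) (hW' : ∀ e, W' e ∈ Matrix.unitaryGroup (Fin n) ℂ) :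
    |linkDeriv e (B.T a) (termF lnk pol z x (jointProj (casimirFamily lnk pol B) m v)) W
        - linkDeriv e (B.T a) (termF lnk pol z x (jointProj (casimirFamily lnk pol B) m v)) W'|
      ≤ ‖z‖ * ‖x‖ * (Real.sqrt (m e : ℂ).re * ‖jointProj (casimirFamily lnk pol B) m v‖)
          * ∑ s, ∑ i, ∑ j, ‖(W (lnk s) - W' (lnk s)) i j‖ := by
  rw [linkDeriv_termF_skew lnk pol z x _ e (skew_T B a), linkDeriv_termF_skew lnk pol z x _ e (skew_T B a),
    neg_sub_neg, abs_sub_comm]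
  refine (abs_termF_sub_termF_le lnk pol z x _ hW hW').trans ?_
  gcongr
  exact norm_genCLM_jointProj_le lnk pol B m e a v

end Summit.Ventures.LatticeQCDFlow.TrivializingMaps.RankOne
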